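import Literature.MathematicalPhysics.QuantumFieldTheory.Balaban1983to89.B7Eq136SecondOrder
import Literature.MathematicalPhysics.QuantumFieldTheory.Balaban1983to89.B8Prop7AdmittedFamily

/-!
# `Balaban1983to89.B7Eq136SecondOrderSkewAdjoint` — T. Bałaban, *Averaging operations for lattice gauge theories*, Commun. Math. Phys.
**98** (1985) 17–51 [Balaban1985Averaging], pp. 20–21 with (22)–(23), (121)–(127) pp. 36–37, (136) p. 39: **THE AVERAGING MAPS TAKE
`𝔤`-VALUED FIELDS TO `𝔤`-VALUED FIELDS — `Q(V₀, A)`, the composites `Q_j(U₀, ·)`, their linear parts, the remainders `C_j(U₀, ·)` and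
the second-order form `C_j⁽²⁾(U₀, ·)` are SKEW-ADJOINT at skew-adjoint arguments over a unitary background; hence the REALITY LAW
`(D²[C_j](0)(a)(a′))⋆ = −D²[C_j](0)(a⋆)(a′⋆)` of the polarisation**

statement-level skeleton of published theorems with citation tags; proofs where landed; nothing here is a claim about the Yang–Mills mass gap

PDF held: `paper:balaban1985-cmp98-averaging` (journal page = PDF page + 16); pp. 20–21, 36–39 through the verbatim quotations of
`B7Prop2Explicit` ((19)–(23), (42)), `B7Prop3GeneralLinear` ((121)–(122)), `B7Prop4GeneralLevels` ((127)), `B7Eq136SecondOrder` ((136)).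

THE PRINT.  p. 20: *«The group G is obtained by applying the function e^{iA} to A ∈ 𝔤»*; (22)–(23) p. 21: the logarithm of a unitary
matrix close to `1` is `i`·(hermitian); p. 38, Proposition 4: *«Q_k(U₀, ηA, c) = (1/i) log(U̿₁ᵏ)_c»* for `U₁ = e^{iηA}`, `A ∈ 𝔤`; (136) p. 39:
*«C_k(U₀, A) = C_k^{(2)}(U₀, A) + C_k^{(3)}(U₀, A) + …»*.  Print works throughout with `𝔤`-valued fields (`𝔤 =` hermitian matrices, the
factor `i` displayed); in the lineage's convention the `i` is absorbed (`B7Prop3GeneralLinear.Qcov`: `V₁ = e^{A}`, `Q = log V̿₁`), so «`𝔤`-valued»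
reads «skew-adjoint-valued».  That the averaging maps preserve `𝔤`-valuedness is TACIT in print — it is what makes `U̿₁ᵏ ∈ G` and
`(1/i) log U̿₁ᵏ ∈ 𝔤` meaningful; it is the unitary-group closure of the averages (`B7Prop2Explicit.avgClosed_unitaryUnits`, (42) with
(22)–(23)) pushed through the composites (127) and the Taylor coefficients (136).

WHY THIS FILE (cell `pub-ymgap`, seat dag-n06-l g34, programme P-C2 piece P3; memo `HOME/pub-ymgap-dag-n06-l/C2-INSTANCE-MEMO.md`).  The N06
certificate displays `h𝔠real : ∀ x U, (U SU(N)-valued) → ∀ A A′, (𝔠 x).form U (star A) (star A′) = star ((𝔠 x).form U A A′)` for [5]'s form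
letter `𝔠` (def-Y `Node00/OpsYDelta2Form`, Hermitian picture); for the intended inhabitant — the polarisation of [B7]'s `C_j⁽²⁾` read on the
member torus, times `±i` — this is exactly the reality law proved here on the `ℤᵈ` carrier, at every unitary-valued regular background.

WHAT THIS FILE PROVES (theorems only; 0 sorry; C⋆-algebra fibre `𝔸`, e.g. `M_N(ℂ)`; regime = that of `B7Eq136SecondOrder` with the
gauge group `G ≤ U(𝔸)`).
* §0 `star_mlog_eq_neg_of_norm_lt` ((22)–(23) with the smallness read on `log u` instead of `u − 1`), `skew_of_hasDerivAt` (the real-ray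
  difference-quotient principle) and private plumbing.
* §1 one step (121): `expCfg_mem_unitary`, `tild_mem_unitary`, `dbavgCov_mem_unitary` (the frames by `B8Prop7AdmittedFamily.wframe_mem_unitaryUnits`,
  REUSED BY NAME), ★ `star_Qcov_eq_neg`
  (`V₀` unitary-valued with regular block loops, `A` skew-valued and small, `‖Q(V₀, A, c)‖ < ln 2` ⟹ `Q(V₀, A, c)⋆ = −Q(V₀, A, c)`).
* §2 the composites (127): ★ `star_logCovIter_eq_neg` (all `j ≤ k`, regime of Proposition 4, `B` skew-valued with `sup‖B‖ ≤ b`).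
* §3 ★ `star_linCovIter_eq_neg`, ★ `star_CCovIter_eq_neg` (the linear part (122) as a limit of skew difference quotients; `C_j = Q_j − lin`).
* §4 on `𝔸^S`: `star_insCfg`, `star_fderiv_CCovIter_ins` (first derivative at a skew point in a skew direction), `star_snd_fderiv_CCovIter_ins_skew`,
  ★★ `star_snd_fderiv_CCovIter_ins` (THE REALITY LAW, all `a, a′`: `(D²f(0)(a)(a′))⋆ = −D²f(0)(a⋆)(a′⋆)`, by the real-form decomposition
  `a = ½(a − a⋆) + i·(−i/2)(a + a⋆)` and `ℂ`-bilinearity), ★ `star_CCovIter2_ins` (`C_j⁽²⁾(U₀, ins_S a)⋆ = −C_j⁽²⁾(U₀, ins_S a⋆)`).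
NOT CLAIMED: anything at a non-unitary background; the torus reading; the factor `±i` of def-Y's Hermitian picture (the consumer's one line);
`su(N)`-valuedness (tracelessness).

PRIOR TWIN (cited, not importable here).  The pub-balaban NE7c crew proved the ⋆-structure of (89) and the skewness of `Q_j` and of the
FIRST-order linear part on the Summits side — `Summits/QuantumFields/BalabanUV/T4Continuum/Support/ShellMeasureLandauCorrectionReal.lean`
(`tHol_mem_unitary`, `Fcov_mem_skew`, `wframe_mem_unitary`, `dbavgCov_mem_unitary`, `star_Qcov_eq_neg`, `logCovIter_mem_skew`, `landauLin_mem_skewPi`;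
leaf-04, row S64 f2, in the regime of their `ShellMeasureAverageProp4General.prop4_general_bounds`).  A `Literature` module cannot import a `Summits`
module, and the [B7] fact belongs here next to `B7Eq136SecondOrder`; so §0–§3 re-prove those steps in the regime of `B7Eq123General.prop4_general`
(the regime of `B7Eq136SecondOrder.ineq149_secondOrder`, so that §4 composes with (149)), and §4 — the SECOND-order polarisation law — is new.
-/

noncomputable section

open scoped BigOperators Topology
open NormedSpace Finset Metric Filter

namespace Literature.MathematicalPhysics.QuantumFieldTheory.Balaban1983to89.B7Eq136SecondOrderSkewAdjoint

open B7Prop1Explicit B7Prop2Explicit B7Prop3Flat B7Eq92Concrete B7Prop3GeneralLinear B7Prop3GeneralAnalytic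
  B7Prop4GeneralLevels B7Eq123General B7Prop5GeneralInduction B7Eq136SecondOrder MatrixLog
open B8Prop7AdmittedFamily (tHol_mem_unitaryUnits wframe_mem_unitaryUnits)

-- `Site` alone would resolve to the torus sites of `Setup.lean`; re-export the `ℤ^d` sites of `B7Prop1Explicit`.
export B7Prop1Explicit (Site)

variable {d : ℕ}

/-! ## §0 Generic: the logarithm of a unitary, closedness of the skew-adjoint part -/

section Generic

variable {𝔸 : Type*} [CStarAlgebra 𝔸]

/-- **(22)–(23) with the smallness read on the logarithm**: for a unitary `u` in the domain of the series logarithm (`‖u − 1‖ < 1`) whose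
logarithm is short (`‖log u‖ < ln 2`), `(log u)⋆ = −log u` — `e^{(log u)⋆} = u⋆ = u⁻¹ = e^{−log u}` and `log ∘ exp = id` on `‖·‖ < ln 2`.
[cite: Balaban1985Averaging, (22)–(23) p.21] -/
theorem star_mlog_eq_neg_of_norm_lt {u : 𝔸} (hu : u ∈ unitary 𝔸) (h1 : ‖u - 1‖ < 1) (hX : ‖mlog u‖ < Real.log 2) :
    star (mlog u) = -mlog u := by
  set X := mlog u with hXdef
  have hexpX : exp X = u := exp_mlog h1
  have hinv : exp (-X) * exp X = 1 := (expUnit X).inv_val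
  have hneg : exp (-X) = star u := by
    calc exp (-X) = exp (-X) * (u * star u) := by rw [Unitary.mul_star_self_of_mem hu, mul_one]
      _ = (exp (-X) * exp X) * star u := by rw [hexpX, mul_assoc]
      _ = star u := by rw [hinv, one_mul]
  have hstar : exp (star X) = star u := by rw [← star_exp, hexpX]
  calc star X = mlog (exp (star X)) := (B7BlockAvgLog.mlog_exp (by rw [norm_star]; exact hX)).symm
    _ = mlog (exp (-X)) := by rw [hstar, hneg]
    _ = -X := B7BlockAvgLog.mlog_exp (by rw [norm_neg]; exact hX)

/-- the skew-adjoint elements form a closed set. [folklore] -/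
private theorem isClosed_skew : IsClosed {x : 𝔸 | star x = -x} :=
  isClosed_eq continuous_star continuous_neg

/-- a limit of eventually skew-adjoint values is skew-adjoint. [folklore] -/
private theorem skew_of_tendsto {ι : Type*} {l : Filter ι} [l.NeBot] {f : ι → 𝔸} {x : 𝔸} (hf : Tendsto f l (𝓝 x))
    (h : ∀ᶠ i in l, star (f i) = -f i) : star x = -x :=
  isClosed_skew.mem_of_tendsto hf h

/-- a real multiple of a skew-adjoint element is skew-adjoint. [folklore] -/
private theorem skew_smul_real {X : 𝔸} (hX : star X = -X) (r : ℝ) : star ((r : ℂ) • X) = -((r : ℂ) • X) := by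
  rw [star_smul, Complex.star_def, Complex.conj_ofReal, hX, smul_neg]

/-- real scalars written in `ℝ`: `(r • X)⋆ = −(r • X)`. [folklore] -/
private theorem skew_smul_real' {X : 𝔸} (hX : star X = -X) (r : ℝ) : star (r • X) = -(r • X) := by
  rw [star_smul, star_trivial, hX, smul_neg]

/-- `positive reals, read in `ℂ`, tend to `0` within `ℂ ∖ {0}` (the real ray inside the punctured plane). [folklore] -/
private theorem tendsto_ofReal_nhdsGT : Tendsto (fun r : ℝ => (r : ℂ)) (𝓝[>] (0 : ℝ)) (𝓝[≠] (0 : ℂ)) := by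
  have h : ContinuousWithinAt (fun r : ℝ => (r : ℂ)) (Set.Ioi 0) 0 := Complex.continuous_ofReal.continuousWithinAt
  have h2 := h.tendsto_nhdsWithin (t := {(0 : ℂ)}ᶜ) fun r hr => by
    simpa using (ne_of_gt (Set.mem_Ioi.mp hr))
  simpa using h2

/-- **the difference-quotient principle**: if `g` has complex derivative `D` at `0`, `g(0) = 0`, and `g(r)` is skew-adjoint for all small
real `r > 0`, then `D` is skew-adjoint (`D = lim_{r→0⁺} r⁻¹g(r)`, real multiples and limits of skew elements are skew) — the way print's
(137) derivatives of `𝔤`-valued functions stay in `𝔤`. [cite: Balaban1985Averaging, (137) p.39, (22)–(23) p.21, bookkeeping] -/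
theorem skew_of_hasDerivAt {g : ℂ → 𝔸} {D : 𝔸} (hg : HasDerivAt g D 0) (h0 : g 0 = 0)
    (hskew : ∀ᶠ r : ℝ in 𝓝[>] 0, star (g r) = -g r) : star D = -D := by
  have hlim : Tendsto (fun t : ℂ => t⁻¹ • g t) (𝓝[≠] (0 : ℂ)) (𝓝 D) := by
    have h := hg.tendsto_slope_zero
    simp only [zero_add] at h
    refine h.congr' (Eventually.of_forall fun t => ?_)
    rw [h0, sub_zero]
  have hlimR := hlim.comp tendsto_ofReal_nhdsGT
  refine skew_of_tendsto hlimR ?_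
  filter_upwards [hskew] with r hr
  show star (((r : ℂ))⁻¹ • g r) = -(((r : ℂ))⁻¹ • g r)
  rw [← Complex.ofReal_inv, skew_smul_real hr]

end Generic

/-! ## §1 One step: `Q(V₀, A, c) = log V̿₁(c)` is skew-adjoint at skew `A` over a unitary regular background -/

section OneStep

variable {𝔸 : Type*} [CStarAlgebra 𝔸]

/-- `e^{A}` is unitary-valued for a skew-valued field. [cite: Balaban1985Averaging, p.20 («G is obtained by applying e^{iA} to A ∈ 𝔤»)] -/
theorem expCfg_mem_unitary {A : Site d → Fin d → 𝔸} (hA : ∀ x κ, star (A x κ) = -A x κ) (x : Site d) (κ : Fin d) :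
    expCfg A x κ ∈ unitaryUnits 𝔸 := by
  rw [mem_unitaryUnits, expCfg, val_expUnit]
  letI : NormedAlgebra ℚ 𝔸 := NormedAlgebra.restrictScalars ℚ ℂ 𝔸
  exact NormedSpace.exp_mem_unitary_of_mem_skewAdjoint (skewAdjoint.mem_iff.2 (hA x κ))

/-- `Ṽ₁(c) = (\overline{V₁V₀})_c(V̄₀)_c⁻¹` (65) is unitary when both one-step averages are ((42) for `U(𝔸)`-valued data with block loops
within `¼`). [cite: Balaban1985Averaging, (65) p.29, (42) p.23] -/
theorem tild_mem_unitary (L : ℕ) {V₀ V₁ : Site d → Fin d → 𝔸ˣ} (hV₀ : ∀ x κ, V₀ x κ ∈ unitaryUnits 𝔸)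
    (hV₁ : ∀ x κ, V₁ x κ ∈ unitaryUnits 𝔸) (q : Site d) (κ : Fin d)
    (hW : ∀ r : Fin d → Fin L, ‖((Wcx L (V₁ * V₀) q κ (boxVec L r) : 𝔸ˣ) : 𝔸) - 1‖ ≤ 1 / 4)
    (hW₀ : ∀ r : Fin d → Fin L, ‖((Wcx L V₀ q κ (boxVec L r) : 𝔸ˣ) : 𝔸) - 1‖ ≤ 1 / 4) :
    tild L V₀ V₁ q κ ∈ unitaryUnits 𝔸 := by
  rw [tild_apply]
  exact (unitaryUnits 𝔸).mul_mem
    (bavg_mem_unitaryUnits (fun x κ' => (unitaryUnits 𝔸).mul_mem (hV₁ x κ') (hV₀ x κ')) L q κ hW)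
    ((unitaryUnits 𝔸).inv_mem (bavg_mem_unitaryUnits hV₀ L q κ hW₀))

/-- **the double-bar average (89) is unitary** at unitary data in the log domain (block loops of `V₁V₀` and `V₀` within `¼`, twisted tree
holonomies at `c₋`, `c₊` within `¼`). [cite: Balaban1985Averaging, (89) p.31, (42) p.23, (22)–(23) p.21] -/
theorem dbavgCov_mem_unitary (L : ℕ) {V₀ V₁ : Site d → Fin d → 𝔸ˣ} (hV₀ : ∀ x κ, V₀ x κ ∈ unitaryUnits 𝔸)
    (hV₁ : ∀ x κ, V₁ x κ ∈ unitaryUnits 𝔸) (q : Site d) (κ : Fin d)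
    (hW : ∀ r : Fin d → Fin L, ‖((Wcx L (V₁ * V₀) q κ (boxVec L r) : 𝔸ˣ) : 𝔸) - 1‖ ≤ 1 / 4)
    (hW₀ : ∀ r : Fin d → Fin L, ‖((Wcx L V₀ q κ (boxVec L r) : 𝔸ˣ) : 𝔸) - 1‖ ≤ 1 / 4)
    (hT₁ : ∀ r : Fin d → Fin L, ‖((tHol V₀ V₁ q (treeWord (boxVec L r)) : 𝔸ˣ) : 𝔸) - 1‖ ≤ 1 / 4)
    (hT₂ : ∀ r : Fin d → Fin L, ‖((tHol V₀ V₁ (q + (L : ℤ) • e κ) (treeWord (boxVec L r)) : 𝔸ˣ) : 𝔸) - 1‖ ≤ 1 / 4) :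
    dbavgCov L V₀ V₁ q κ ∈ unitaryUnits 𝔸 := by
  unfold dbavgCov
  refine (unitaryUnits 𝔸).mul_mem ((unitaryUnits 𝔸).mul_mem ((unitaryUnits 𝔸).inv_mem (wframe_mem_unitaryUnits L hV₀ hV₁ q hT₁))
    (tild_mem_unitary L hV₀ hV₁ q κ hW hW₀)) ?_
  rw [Rc_apply]
  have hb := bavg_mem_unitaryUnits hV₀ L q κ hW₀
  exact (unitaryUnits 𝔸).mul_mem ((unitaryUnits 𝔸).mul_mem hb (wframe_mem_unitaryUnits L hV₀ hV₁ _ hT₂))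
    ((unitaryUnits 𝔸).inv_mem hb)

variable [Nontrivial 𝔸]

/-- **★ `Q(V₀, A, c)⋆ = −Q(V₀, A, c)` — THE ONE-STEP MAP (121) TAKES `𝔤` TO `𝔤`**: over a unitary-valued background with `α`-regular block
loops at `c` (`α ≤ 1/64`), for a skew-valued field with `(2d+2)L·sup‖A‖ ≤ θ ≤ 1/64`, the double-bar average `V̿₁(c)` of `V₁ = e^{A}` is
unitary and in the log domain (`B7Prop3GeneralAnalytic.logDomainCov`); if moreover `‖Q(V₀, A, c)‖ < ln 2` (print's (131): `|Q| ≦ 2Lʲ|A|`),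
then `Q(V₀, A, c) = log V̿₁(c)` is skew-adjoint. [cite: Balaban1985Averaging, (121) p.36, Proposition 4 p.38, (22)–(23) p.21] -/
theorem star_Qcov_eq_neg {L : ℕ} (hL : 1 ≤ L) {V₀ : Site d → Fin d → 𝔸ˣ} (hV₀ : ∀ x κ, V₀ x κ ∈ unitaryUnits 𝔸)
    {A : Site d → Fin d → 𝔸} (hAs : ∀ x κ, star (A x κ) = -A x κ) {a θ α : ℝ} (ha : 0 ≤ a) (hA : ∀ x κ, ‖A x κ‖ ≤ a)
    (hθ : ((2 * (d * L) + L + L : ℕ) : ℝ) * a ≤ θ) (hθ0 : 0 ≤ θ) (hθ1 : θ ≤ 1 / 64)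
    (q : Site d) (κ : Fin d) (hα1 : α ≤ 1 / 64)
    (hreg : ∀ r : Fin d → Fin L, ‖((Wcx L V₀ q κ (boxVec L r) : 𝔸ˣ) : 𝔸) - 1‖ ≤ α)
    (hQ : ‖Qcov L V₀ A q κ‖ < Real.log 2) :
    star (Qcov L V₀ A q κ) = -Qcov L V₀ A q κ := by
  have hV₀' : ∀ x κ, V₀ x κ ∈ U1 𝔸 := fun x κ => unitaryUnits_le_U1 (hV₀ x κ)
  obtain ⟨hW, hT₁, hT₂, hD⟩ := logDomainCov hL hV₀' A ha hA hθ hθ0 hθ1 q κ hα1 hreg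
  have hmem : dbavgCov L V₀ (expCfg A) q κ ∈ unitaryUnits 𝔸 :=
    dbavgCov_mem_unitary L hV₀ (expCfg_mem_unitary hAs) q κ (fun r => (hW r).trans (by norm_num))
      (fun r => (hreg r).trans (hα1.trans (by norm_num))) (fun r => (hT₁ r).trans (by norm_num)) (fun r => (hT₂ r).trans (by norm_num))
  unfold Qcov at hQ ⊢
  exact star_mlog_eq_neg_of_norm_lt ((mem_unitaryUnits).1 hmem) (hD.trans_lt (by norm_num)) hQ

end OneStep

/-! ## §2 The composites (127): `Q_j(U₀, ηB)⋆ = −Q_j(U₀, ηB)` in the regime of Proposition 4 -/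

section Levels

variable {𝔸 : Type*} [CStarAlgebra 𝔸] [Nontrivial 𝔸]

/-- print's threshold in the `θ`-currency of `B7Prop3GeneralAnalytic`: `a ≤ c₃(d, L) = 1/(128(d+1)L)` gives `(2d+2)L·a ≤ 1/64`
(private arithmetic helper, as in `B7Eq123General`). [cite: Balaban1985Averaging, Proposition 3 p.36] -/
private theorem theta_le_of_le_c3 {L : ℕ} (hL : 1 ≤ L) {a : ℝ} (hac : a ≤ c3 d L) :
    ((2 * (d * L) + L + L : ℕ) : ℝ) * a ≤ 1 / 64 := by
  have hL1 : (1 : ℝ) ≤ L := by exact_mod_cast hL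
  have hcast : ((2 * (d * L) + L + L : ℕ) : ℝ) = 2 * ((d : ℝ) + 1) * L := by push_cast; ring
  rw [hcast]
  have hpos : (0 : ℝ) < 128 * ((d : ℝ) + 1) * L := by positivity
  have h1 : a * (128 * ((d : ℝ) + 1) * L) ≤ 1 := by
    have := mul_le_mul_of_nonneg_right hac hpos.le
    rwa [c3, one_div, inv_mul_cancel₀ hpos.ne'] at this
  nlinarith

/-- `c₃(d, L) < ln 2` (`c₃ ≤ 1/128`). [folklore] -/
private theorem c3_lt_log_two {L : ℕ} (hL : 1 ≤ L) : c3 d L < Real.log 2 := by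
  have hL1 : (1 : ℝ) ≤ L := by exact_mod_cast hL
  have hpos : (0 : ℝ) < 128 * ((d : ℝ) + 1) * L := by positivity
  have h1 : c3 d L ≤ 1 / 128 := by
    rw [c3]
    apply div_le_div_of_nonneg_left zero_le_one (by norm_num)
    have hd : (1 : ℝ) ≤ (d : ℝ) + 1 := by have := Nat.cast_nonneg (α := ℝ) d; linarith
    nlinarith
  have := Real.log_two_gt_d9
  linarith

/-- **★ `Q_j(U₀, ηB)⋆ = −Q_j(U₀, ηB)` FOR EVERY `j ≤ k` — THE COMPOSITES (127) TAKE `𝔤` TO `𝔤`**: in the regime of Proposition 4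
(`B7Eq123General.prop4_general`: `L ≥ 2`, `U₀` valued in an averaging-closed `G ≤ U(𝔸)`, (52) `pdev U₀ < α₀L^{−2k}`, `C₀α₀ ≤ ⅓`, `4α₀ ≤ c₂′`,
`sup‖B‖ ≤ b`, `e^{4cα₀}(1 + 8C₁Lᵏb) ≤ 2`, `2Lᵏb ≤ c₃`) and for a SKEW-valued `B`, every composite `logCovIter L U₀ B j c` is skew-adjoint.
Induction on `j` = print's «composition of the functions (127)»: the one-step map at the level background `Ū₀ʲ` (unitary-valued and regular,
`level_regularity ∕ level_data ∕ blockLoops_of_pdev`) applied to a skew field of sup `≤ 2Lʲb` ((131)) has a skew value because that value has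
norm `≤ 2L^{j+1}b ≤ c₃ < ln 2` ((131) at `j+1`) — `star_Qcov_eq_neg`. [cite: Balaban1985Averaging, (127) p.37, Proposition 4 (131) p.38, (22)–(23) p.21] -/
theorem star_logCovIter_eq_neg (L : ℕ) (hL : 2 ≤ L) {G : Subgroup 𝔸ˣ} (hG : AvgClosed d L G) (hGU : G ≤ unitaryUnits 𝔸) (k : ℕ)
    (U₀ : Site d → Fin d → 𝔸ˣ) (hU₀ : ∀ x κ, U₀ x κ ∈ G) {α₀ : ℝ} (hα : 0 < α₀)
    (hα3 : C0 d * α₀ ≤ 1 / 3) (hα4 : 4 * α₀ ≤ c2' d L) (h52 : pdev U₀ < α₀ * (((L : ℝ) ^ k)⁻¹) ^ 2)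
    (B : Site d → Fin d → 𝔸) {b : ℝ} (hb : 0 ≤ b) (hB : ∀ x κ, ‖B x κ‖ ≤ b) (hBs : ∀ x κ, star (B x κ) = -B x κ)
    (hsmall : Real.exp (4 * (800 * ((d : ℝ) + 1) ^ 2 * ((d : ℝ) + 4)) * α₀)
      * (1 + 8 * (131072 * ((d : ℝ) + 1) ^ 2) * ((L : ℝ) ^ k * b)) ≤ 2)
    (hc₃ : 2 * ((L : ℝ) ^ k * b) ≤ c3 d L) :
    ∀ j ≤ k, ∀ (z : Site d) (κ : Fin d), star (logCovIter L U₀ B j z κ) = -logCovIter L U₀ B j z κ := by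
  have hL1 : 1 ≤ L := le_trans (by norm_num) hL
  have hα2 : 2 * α₀ ≤ c2' d L := by linarith
  have h4 := prop4_general L hL hG k U₀ hU₀ hα hα3 hα4 h52 B hb hB hsmall hc₃
  have hlev := level_data L hL hG k U₀ hU₀ hα hα3 hα4 h52
  have hc₃' := levels_le_c3 hL1 hb hc₃
  have hlog2 := c3_lt_log_two (d := d) hL1
  intro j
  induction j with
  | zero => intro _ z κ; simpa only [logCovIter_zero] using hBs z κ
  | succ j ih =>
    intro hjk z κ
    have hj : j < k := Nat.lt_of_succ_le hjk
    obtain ⟨hV₀, hβ0, hβ, hβmax⟩ := hlev j hj.le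
    have hVG : ∀ x κ', avgIter L U₀ j x κ' ∈ unitaryUnits 𝔸 := fun x κ' =>
      hGU ((level_regularity L hL hG k U₀ hU₀ hα hα3 hα2 h52 j hj.le).2 x κ')
    have hA : ∀ x κ', ‖logCovIter L U₀ B j x κ'‖ ≤ 2 * ((L : ℝ) ^ j * b) := (h4 j hj.le).2
    obtain ⟨hreg, hα1⟩ := blockLoops_of_pdev hL1 hV₀ hβ0 hβ hβmax ((L : ℤ) • z) κ
    have hQ : ‖logCovIter L U₀ B (j + 1) z κ‖ < Real.log 2 :=
      ((h4 (j + 1) hjk).2 z κ).trans_lt ((le_trans (by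
        have hL1r : (1 : ℝ) ≤ L := by exact_mod_cast hL1
        have h1 : (L : ℝ) ^ (j + 1) * b ≤ (L : ℝ) ^ k * b := mul_le_mul_of_nonneg_right (pow_le_pow_right₀ hL1r hjk) hb
        linarith) hc₃).trans_lt hlog2)
    rw [logCovIter_succ] at hQ ⊢
    exact star_Qcov_eq_neg hL1 hVG (fun x κ' => ih hj.le x κ') (by positivity) hA le_rfl (by positivity)
      (theta_le_of_le_c3 hL1 (hc₃' j hj)) ((L : ℤ) • z) κ hα1 hreg hQ

/-! ## §3 The linear parts and the remainders `C_j(U₀, ·)` -/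

/-- a uniform sup bound for the linear composites in the regime ((130)+(131): `‖lin‖ ≤ ‖Q_j‖ + ‖Q_j − lin‖`). [cite: Balaban1985Averaging, Proposition 4 (130)–(131) p.38] -/
theorem norm_linCovIter_le (L : ℕ) (hL : 2 ≤ L) {G : Subgroup 𝔸ˣ} (hG : AvgClosed d L G) (k : ℕ)
    (U₀ : Site d → Fin d → 𝔸ˣ) (hU₀ : ∀ x κ, U₀ x κ ∈ G) {α₀ : ℝ} (hα : 0 < α₀)
    (hα3 : C0 d * α₀ ≤ 1 / 3) (hα4 : 4 * α₀ ≤ c2' d L) (h52 : pdev U₀ < α₀ * (((L : ℝ) ^ k)⁻¹) ^ 2)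
    (B : Site d → Fin d → 𝔸) {b : ℝ} (hb : 0 ≤ b) (hB : ∀ x κ, ‖B x κ‖ ≤ b)
    (hsmall : Real.exp (4 * (800 * ((d : ℝ) + 1) ^ 2 * ((d : ℝ) + 4)) * α₀)
      * (1 + 8 * (131072 * ((d : ℝ) + 1) ^ 2) * ((L : ℝ) ^ k * b)) ≤ 2)
    (hc₃ : 2 * ((L : ℝ) ^ k * b) ≤ c3 d L) :
    ∀ j ≤ k, ∀ (z : Site d) (κ : Fin d), ‖linCovIter L U₀ B j z κ‖ ≤
      2 * ((L : ℝ) ^ j * b) + 8 * (131072 * ((d : ℝ) + 1) ^ 2) * Real.exp (4 * (800 * ((d : ℝ) + 1) ^ 2 * ((d : ℝ) + 4)) * α₀)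
          * ((L : ℝ) ^ j * b) ^ 2 := by
  intro j hj z κ
  obtain ⟨h1, h2⟩ := prop4_general L hL hG k U₀ hU₀ hα hα3 hα4 h52 B hb hB hsmall hc₃ j hj
  have h3 : ‖linCovIter L U₀ B j z κ‖ ≤ ‖logCovIter L U₀ B j z κ‖ + ‖logCovIter L U₀ B j z κ - linCovIter L U₀ B j z κ‖ := by
    have := norm_sub_le (logCovIter L U₀ B j z κ) (logCovIter L U₀ B j z κ - linCovIter L U₀ B j z κ)
    rwa [sub_sub_cancel] at this
  exact h3.trans (add_le_add (h2 z κ) (h1 z κ))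

/-- **the one-step LINEAR PART (122) `L(Q(V₀)A)_c` is skew-adjoint at a skew direction** over a unitary regular background: it is the
`t`-derivative at `0` of the analytic slice `t ↦ Q(V₀, tA, c)` (`Q(V₀, 0, c) = 0`), whose values at small REAL `t` are skew (`star_Qcov_eq_neg`,
the smallness `‖Q(V₀, tA, c)‖ < ln 2` holding near `t = 0` by continuity). [cite: Balaban1985Averaging, (122) p.36, (22)–(23) p.21] -/
theorem star_linQcov_eq_neg {L : ℕ} (hL : 1 ≤ L) {V₀ : Site d → Fin d → 𝔸ˣ} (hV₀ : ∀ x κ, V₀ x κ ∈ unitaryUnits 𝔸)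
    {A : Site d → Fin d → 𝔸} (hAs : ∀ x κ, star (A x κ) = -A x κ) {M : ℝ} (hM : 0 ≤ M) (hA : ∀ x κ, ‖A x κ‖ ≤ M)
    (q : Site d) (κ : Fin d) {α : ℝ} (hα1 : α ≤ 1 / 64)
    (hreg : ∀ r : Fin d → Fin L, ‖((Wcx L V₀ q κ (boxVec L r) : 𝔸ˣ) : 𝔸) - 1‖ ≤ α) :
    star (linQcov L V₀ A q κ) = -linQcov L V₀ A q κ := by
  have hV₀' : ∀ x κ, V₀ x κ ∈ U1 𝔸 := fun x κ => unitaryUnits_le_U1 (hV₀ x κ)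
  -- the slice `g(t) = Q(V₀, tA, c)` is analytic at `0` (field `0` there), `g(0) = 0`
  have han : AnalyticAt ℂ (fun t : ℂ => Qcov L V₀ (t • A) q κ) 0 := by
    have hlin : ∀ (x : Site d) (κ' : Fin d), AnalyticAt ℂ (fun t : ℂ => (t • A) x κ') 0 := fun x κ' => by
      show AnalyticAt ℂ (fun t : ℂ => t • A x κ') 0
      exact ((analyticAt_id (𝕜 := ℂ) (E := ℂ) (z := (0 : ℂ))).smul (analyticAt_const (𝕜 := ℂ) (E := ℂ) (v := A x κ') (x := (0 : ℂ))) :)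
    have h := prop3_general_analyticAt_of_le_c3 (fun t : ℂ => t • A) (t₀ := 0) hlin
      hL hV₀' (a := 0) le_rfl (fun x κ' => by simp) (by rw [c3]; positivity) q κ hα1 hreg
    simpa only [Qcov] using h
  have hderiv : HasDerivAt (fun t : ℂ => Qcov L V₀ (t • A) q κ) (linQcov L V₀ A q κ) 0 :=
    han.differentiableAt.hasDerivAt
  have h0 : Qcov L V₀ ((0 : ℂ) • A) q κ = 0 := by rw [zero_smul, Qcov_zero]
  refine skew_of_hasDerivAt hderiv h0 ?_
  -- near `t = 0` the value is short: `‖g(t)‖ < ln 2` by continuity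
  have hcont : ContinuousAt (fun t : ℂ => Qcov L V₀ (t • A) q κ) 0 := han.continuousAt
  have hev : ∀ᶠ t : ℂ in 𝓝 0, ‖Qcov L V₀ (t • A) q κ‖ < Real.log 2 := by
    have h := hcont.norm
    rw [ContinuousAt, h0, norm_zero] at h
    exact h.eventually (gt_mem_nhds (Real.log_pos (by norm_num)))
  have hev' : ∀ᶠ t : ℂ in 𝓝 ((0 : ℝ) : ℂ), ‖Qcov L V₀ (t • A) q κ‖ < Real.log 2 := by rwa [Complex.ofReal_zero]
  have hevR : ∀ᶠ r : ℝ in 𝓝 0, ‖Qcov L V₀ ((r : ℂ) • A) q κ‖ < Real.log 2 :=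
    Complex.continuous_ofReal.continuousAt.eventually hev'
  -- and the field `rA` is skew with `(2d+2)L·r·M ≤ 1/64` for small `r > 0`
  have hθev : ∀ᶠ r : ℝ in 𝓝[>] 0, ((2 * (d * L) + L + L : ℕ) : ℝ) * (r * M) ≤ 1 / 64 := by
    have hc : ContinuousAt (fun r : ℝ => ((2 * (d * L) + L + L : ℕ) : ℝ) * (r * M)) 0 :=
      (continuous_const.mul (continuous_id.mul continuous_const)).continuousAt
    have h := hc.eventually (p := fun x => x < 1 / 64) (by
      simp only [mul_zero, zero_mul]; exact gt_mem_nhds (by norm_num))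
    exact nhdsWithin_le_nhds (h.mono fun r hr => hr.le)
  filter_upwards [nhdsWithin_le_nhds hevR, hθev, self_mem_nhdsWithin] with r hQr hθr hr0
  have hr0' : 0 < r := hr0
  exact star_Qcov_eq_neg hL hV₀ (A := (r : ℂ) • A) (fun x κ' => by rw [Pi.smul_apply, Pi.smul_apply]; exact skew_smul_real (hAs x κ') r)
    (a := r * M) (by positivity)
    (fun x κ' => by
      rw [Pi.smul_apply, Pi.smul_apply, norm_smul, Complex.norm_real, Real.norm_of_nonneg hr0'.le]
      exact mul_le_mul_of_nonneg_left (hA x κ') hr0'.le)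
    le_rfl (by positivity) hθr q κ hα1 hreg hQr

/-- **★ the linear composites (127) take `𝔤` to `𝔤`**: `(LʲηQ_j(U₀)B)⋆ = −LʲηQ_j(U₀)B` for skew `B`, every `j ≤ k`, in the regime of
Proposition 4 over `G ≤ U(𝔸)`. [cite: Balaban1985Averaging, (127) p.37, (122) p.36, (22)–(23) p.21] -/
theorem star_linCovIter_eq_neg (L : ℕ) (hL : 2 ≤ L) {G : Subgroup 𝔸ˣ} (hG : AvgClosed d L G) (hGU : G ≤ unitaryUnits 𝔸) (k : ℕ)
    (U₀ : Site d → Fin d → 𝔸ˣ) (hU₀ : ∀ x κ, U₀ x κ ∈ G) {α₀ : ℝ} (hα : 0 < α₀)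
    (hα3 : C0 d * α₀ ≤ 1 / 3) (hα4 : 4 * α₀ ≤ c2' d L) (h52 : pdev U₀ < α₀ * (((L : ℝ) ^ k)⁻¹) ^ 2)
    (B : Site d → Fin d → 𝔸) {b : ℝ} (hb : 0 ≤ b) (hB : ∀ x κ, ‖B x κ‖ ≤ b) (hBs : ∀ x κ, star (B x κ) = -B x κ)
    (hsmall : Real.exp (4 * (800 * ((d : ℝ) + 1) ^ 2 * ((d : ℝ) + 4)) * α₀)
      * (1 + 8 * (131072 * ((d : ℝ) + 1) ^ 2) * ((L : ℝ) ^ k * b)) ≤ 2)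
    (hc₃ : 2 * ((L : ℝ) ^ k * b) ≤ c3 d L) :
    ∀ j ≤ k, ∀ (z : Site d) (κ : Fin d), star (linCovIter L U₀ B j z κ) = -linCovIter L U₀ B j z κ := by
  have hL1 : 1 ≤ L := le_trans (by norm_num) hL
  have hα2 : 2 * α₀ ≤ c2' d L := by linarith
  have hlev := level_data L hL hG k U₀ hU₀ hα hα3 hα4 h52
  have hlin := norm_linCovIter_le L hL hG k U₀ hU₀ hα hα3 hα4 h52 B hb hB hsmall hc₃
  intro j
  induction j with
  | zero => intro _ z κ; simpa only [linCovIter_zero] using hBs z κ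
  | succ j ih =>
    intro hjk z κ
    have hj : j < k := Nat.lt_of_succ_le hjk
    obtain ⟨hV₀, hβ0, hβ, hβmax⟩ := hlev j hj.le
    have hVG : ∀ x κ', avgIter L U₀ j x κ' ∈ unitaryUnits 𝔸 := fun x κ' =>
      hGU ((level_regularity L hL hG k U₀ hU₀ hα hα3 hα2 h52 j hj.le).2 x κ')
    obtain ⟨hreg, hα1⟩ := blockLoops_of_pdev hL1 hV₀ hβ0 hβ hβmax ((L : ℤ) • z) κ
    rw [linCovIter_succ]
    exact star_linQcov_eq_neg hL1 hVG (fun x κ' => ih hj.le x κ') (by positivity) (hlin j hj.le) ((L : ℤ) • z) κ hα1 hreg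

/-- **★ `C_j(U₀, B)(c)⋆ = −C_j(U₀, B)(c)`** — the remainders (122)/(150) take `𝔤` to `𝔤` (difference of §2 and the linear part).
[cite: Balaban1985Averaging, (122) p.36, (150) p.40, (22)–(23) p.21] -/
theorem star_CCovIter_eq_neg (L : ℕ) (hL : 2 ≤ L) {G : Subgroup 𝔸ˣ} (hG : AvgClosed d L G) (hGU : G ≤ unitaryUnits 𝔸) (k : ℕ)
    (U₀ : Site d → Fin d → 𝔸ˣ) (hU₀ : ∀ x κ, U₀ x κ ∈ G) {α₀ : ℝ} (hα : 0 < α₀)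
    (hα3 : C0 d * α₀ ≤ 1 / 3) (hα4 : 4 * α₀ ≤ c2' d L) (h52 : pdev U₀ < α₀ * (((L : ℝ) ^ k)⁻¹) ^ 2)
    (B : Site d → Fin d → 𝔸) {b : ℝ} (hb : 0 ≤ b) (hB : ∀ x κ, ‖B x κ‖ ≤ b) (hBs : ∀ x κ, star (B x κ) = -B x κ)
    (hsmall : Real.exp (4 * (800 * ((d : ℝ) + 1) ^ 2 * ((d : ℝ) + 4)) * α₀)
      * (1 + 8 * (131072 * ((d : ℝ) + 1) ^ 2) * ((L : ℝ) ^ k * b)) ≤ 2)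
    (hc₃ : 2 * ((L : ℝ) ^ k * b) ≤ c3 d L) :
    ∀ j ≤ k, ∀ (z : Site d) (κ : Fin d), star (CCovIter L U₀ B j z κ) = -CCovIter L U₀ B j z κ := by
  intro j hj z κ
  rw [CCovIter, star_sub, star_logCovIter_eq_neg L hL hG hGU k U₀ hU₀ hα hα3 hα4 h52 B hb hB hBs hsmall hc₃ j hj z κ,
    star_linCovIter_eq_neg L hL hG hGU k U₀ hU₀ hα hα3 hα4 h52 B hb hB hBs hsmall hc₃ j hj z κ]
  abel

end Levels

/-! ## §4 On the variable space `𝔸^S`: the derivatives and the reality law of the polarisation -/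

section PolarisationAlgebra

variable {𝔸 : Type*} [CStarAlgebra 𝔸] (S : Finset (Site d × Fin d))

/-- inserting a skew-valued family of bond variables gives a skew-valued field. [cite: Balaban1985Averaging, p.38 («A_b, b ⊂ Bᵏ(c₋) ∪ Bᵏ(c₊)»), bookkeeping] -/
theorem star_insCfg (v : S → 𝔸) (x : Site d) (κ : Fin d) :
    star (insCfg S v x κ) = insCfg S (star v) x κ := by
  by_cases h : (x, κ) ∈ S <;> simp [insCfg, h]

/-- … in particular skew families give skew fields. [cite: Balaban1985Averaging, p.38, bookkeeping] -/
theorem insCfg_skew {v : S → 𝔸} (hv : star v = -v) (x : Site d) (κ : Fin d) :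
    star (insCfg S v x κ) = -insCfg S v x κ := by
  rw [star_insCfg, hv]
  by_cases h : (x, κ) ∈ S <;> simp [insCfg, h]

/-- the skew part `½(a − a⋆)` is skew. [folklore] -/
private theorem skewPart_skew (a : S → 𝔸) : star ((2 : ℂ)⁻¹ • (a - star a)) = -((2 : ℂ)⁻¹ • (a - star a)) := by
  rw [star_smul, star_sub, star_star, ← smul_neg, neg_sub]
  norm_num

/-- `(−i/2)(a + a⋆)` is skew. [folklore] -/
private theorem iPart_skew (a : S → 𝔸) :
    star ((-(Complex.I * (2 : ℂ)⁻¹)) • (a + star a)) = -((-(Complex.I * (2 : ℂ)⁻¹)) • (a + star a)) := by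
  rw [star_smul, star_add, star_star, add_comm (star a) a, ← neg_smul]
  congr 1
  simp [Complex.conj_I]

/-- the real-form decomposition `a = ½(a − a⋆) + i·(−i/2)(a + a⋆)`. [folklore] -/
private theorem decomp_skew (a : S → 𝔸) :
    a = (2 : ℂ)⁻¹ • (a - star a) + Complex.I • ((-(Complex.I * (2 : ℂ)⁻¹)) • (a + star a)) := by
  rw [smul_smul, show Complex.I * -(Complex.I * (2 : ℂ)⁻¹) = (2 : ℂ)⁻¹ by
    rw [mul_neg, ← mul_assoc, Complex.I_mul_I]; ring]
  rw [smul_sub, smul_add]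
  rw [show (2 : ℂ)⁻¹ • a - (2 : ℂ)⁻¹ • star a + ((2 : ℂ)⁻¹ • a + (2 : ℂ)⁻¹ • star a) = ((2 : ℂ)⁻¹ + (2 : ℂ)⁻¹) • a by
    rw [add_smul]; abel]
  norm_num

/-- … and of its adjoint: `a⋆ = −½(a − a⋆) + i·(−i/2)(a + a⋆)`. [folklore] -/
private theorem decomp_star_skew (a : S → 𝔸) :
    star a = -((2 : ℂ)⁻¹ • (a - star a)) + Complex.I • ((-(Complex.I * (2 : ℂ)⁻¹)) • (a + star a)) := by
  rw [smul_smul, show Complex.I * -(Complex.I * (2 : ℂ)⁻¹) = (2 : ℂ)⁻¹ by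
    rw [mul_neg, ← mul_assoc, Complex.I_mul_I]; ring]
  rw [smul_sub, smul_add]
  rw [show -((2 : ℂ)⁻¹ • a - (2 : ℂ)⁻¹ • star a) + ((2 : ℂ)⁻¹ • a + (2 : ℂ)⁻¹ • star a) = ((2 : ℂ)⁻¹ + (2 : ℂ)⁻¹) • star a by
    rw [add_smul]; abel]
  norm_num

/-- **the algebra of the reality law**: a continuous `ℂ`-bilinear map `D` on `𝔸^S` that is skew-valued on skew × skew satisfies
`(D a a′)⋆ = −D a⋆ a′⋆` for ALL `a, a′` (expand both sides along `a = x + iy`, `a⋆ = −x + iy` with `x, y` skew) — the passage from print's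
`𝔤`-valued quadratic form to its complex-bilinear polarisation ([B11] (56)). [cite: Balaban1985Variational, (56) p.286, bookkeeping]
[cite: Balaban1985Averaging, (22)–(23) p.21, bookkeeping] -/
theorem star_apply_eq_neg_of_skew (D : (S → 𝔸) →L[ℂ] (S → 𝔸) →L[ℂ] 𝔸)
    (hD : ∀ x y : S → 𝔸, star x = -x → star y = -y → star (D x y) = -D x y) (a a' : S → 𝔸) :
    star (D a a') = -D (star a) (star a') := by
  set x := (2 : ℂ)⁻¹ • (a - star a) with hx
  set y := (-(Complex.I * (2 : ℂ)⁻¹)) • (a + star a) with hy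
  set x' := (2 : ℂ)⁻¹ • (a' - star a') with hx'
  set y' := (-(Complex.I * (2 : ℂ)⁻¹)) • (a' + star a') with hy'
  have hxs : star x = -x := skewPart_skew S a
  have hys : star y = -y := iPart_skew S a
  have hxs' : star x' = -x' := skewPart_skew S a'
  have hys' : star y' = -y' := iPart_skew S a'
  have ha : a = x + Complex.I • y := decomp_skew S a
  have ha' : a' = x' + Complex.I • y' := decomp_skew S a'
  have hsa : star a = -x + Complex.I • y := decomp_star_skew S a
  have hsa' : star a' = -x' + Complex.I • y' := decomp_star_skew S a'
  rw [hsa, hsa']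
  conv_lhs => rw [ha, ha']
  simp only [map_add, map_smul, map_neg, add_apply, smul_apply, neg_apply, star_add, star_smul,
    hD x x' hxs hxs', hD x y' hxs hys', hD y x' hys hxs', hD y y' hys hys', Complex.star_def, Complex.conj_I, smul_neg,
    neg_smul, neg_neg]
  abel

end PolarisationAlgebra

section Polarisation

variable {𝔸 : Type*} [CStarAlgebra 𝔸] [Nontrivial 𝔸]

variable (L : ℕ) (hL : 2 ≤ L) {G : Subgroup 𝔸ˣ} (hG : AvgClosed d L G) (hGU : G ≤ unitaryUnits 𝔸) (k : ℕ)
  (U₀ : Site d → Fin d → 𝔸ˣ) (hU₀ : ∀ x κ, U₀ x κ ∈ G) {α₀ : ℝ} (hα : 0 < α₀)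
  (hα3 : C0 d * α₀ ≤ 1 / 3) (hα4 : 4 * α₀ ≤ c2' d L) (h52 : pdev U₀ < α₀ * (((L : ℝ) ^ k)⁻¹) ^ 2)
  {b : ℝ} (hb : 0 < b)
  (hsmall : Real.exp (4 * (800 * ((d : ℝ) + 1) ^ 2 * ((d : ℝ) + 4)) * α₀)
    * (1 + 8 * (131072 * ((d : ℝ) + 1) ^ 2) * ((L : ℝ) ^ k * b)) ≤ 2)
  (hc₃ : 4 * ((L : ℝ) ^ k * b) < c3 d L)
  (S : Finset (Site d × Fin d))

include hL hG hGU hU₀ hα hα3 hα4 h52 hb hsmall hc₃ in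
/-- the remainder on `𝔸^S` is skew at skew families of sup norm `≤ b` (§3 with `B = ins_S v`). [cite: Balaban1985Averaging, (136) p.39, (22)–(23) p.21] -/
theorem star_CCovIter_ins_eq_neg {j : ℕ} (hj : j ≤ k) (z : Site d) (κ : Fin d) {v : S → 𝔸} (hv : star v = -v)
    (hvb : ‖v‖ ≤ b) : star (CCovIter L U₀ (insCfg S v) j z κ) = -CCovIter L U₀ (insCfg S v) j z κ := by
  have hc₃' : 2 * ((L : ℝ) ^ k * b) ≤ c3 d L := by
    have : 0 ≤ (L : ℝ) ^ k * b := by positivity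
    linarith
  exact star_CCovIter_eq_neg L hL hG hGU k U₀ hU₀ hα hα3 hα4 h52 (insCfg S v) hb.le
    (fun x κ' => (norm_insCfg_le S v x κ').trans hvb) (insCfg_skew S hv) hsmall hc₃' j hj z κ

include hL hG hGU hU₀ hα hα3 hα4 h52 hb hsmall hc₃ in
/-- **the first derivative `D[C_j(U₀, ins_S ·)(c)](v)(w)` is skew-adjoint** at a skew point `v` of the OPEN polydisc `‖v‖ < b` in a skew
direction `w`: it is the limit of the skew difference quotients `r⁻¹(C_j(ins(v + rw)) − C_j(ins v))`, `r → 0⁺`.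
[cite: Balaban1985Averaging, (137) p.39, (136) p.39, (22)–(23) p.21] -/
theorem star_fderiv_CCovIter_ins {j : ℕ} (hj : j ≤ k) (z : Site d) (κ : Fin d) {v w : S → 𝔸} (hv : star v = -v)
    (hvb : ‖v‖ < b) (hw : star w = -w) :
    star (fderiv ℂ (fun a' : S → 𝔸 => CCovIter L U₀ (insCfg S a') j z κ) v w) =
      -fderiv ℂ (fun a' : S → 𝔸 => CCovIter L U₀ (insCfg S a') j z κ) v w := by
  set f : (S → 𝔸) → 𝔸 := fun a' => CCovIter L U₀ (insCfg S a') j z κ with hf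
  have han : AnalyticAt ℂ f v :=
    analyticAt_CCovIter_ins L hL hG k U₀ hU₀ hα hα3 hα4 h52 hb hsmall hc₃ S hj z κ (fun s => (norm_le_pi_norm v s).trans hvb.le)
  have hF : HasFDerivAt f (fderiv ℂ f v) v := han.differentiableAt.hasFDerivAt
  -- the slice `g(t) = f(v + t·w) − f(v)` has derivative `Df(v)(w)` at `0` and `g(0) = 0`
  have hline : HasDerivAt (fun t : ℂ => v + t • w) w 0 := by
    simpa using ((hasDerivAt_id (0 : ℂ)).smul_const w).const_add v
  have hg : HasDerivAt (fun t : ℂ => f (v + t • w) - f v) (fderiv ℂ f v w) 0 := by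
    have h1 : HasFDerivAt f (fderiv ℂ f v) (v + (0 : ℂ) • w) := by rwa [zero_smul, add_zero]
    have h2 := h1.comp_hasDerivAt (0 : ℂ) hline
    simpa [Function.comp_def] using h2.sub_const (f v)
  refine skew_of_hasDerivAt hg (by simp) ?_
  -- for small `r > 0` both values are skew (the point `v + rw` stays in the closed polydisc)
  have hroom : ∀ᶠ r : ℝ in 𝓝[>] 0, ‖v‖ + r * ‖w‖ ≤ b := by
    have hc : ContinuousAt (fun r : ℝ => ‖v‖ + r * ‖w‖) 0 := (continuous_const.add (continuous_id.mul continuous_const)).continuousAt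
    have h := hc.eventually (p := fun x => x < b) (by simp only [zero_mul, add_zero]; exact gt_mem_nhds hvb)
    exact nhdsWithin_le_nhds (h.mono fun r hr => hr.le)
  filter_upwards [hroom, self_mem_nhdsWithin] with r hr hr0
  have hr0' : 0 < r := hr0
  have hvs : star (v + (r : ℂ) • w) = -(v + (r : ℂ) • w) := by
    rw [star_add, star_smul, hv, hw, Complex.star_def, Complex.conj_ofReal, smul_neg, neg_add]
  have hvb' : ‖v + (r : ℂ) • w‖ ≤ b :=
    (norm_add_le _ _).trans (by rw [norm_smul, Complex.norm_real, Real.norm_of_nonneg hr0'.le]; exact hr)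
  rw [star_sub, star_CCovIter_ins_eq_neg L hL hG hGU k U₀ hU₀ hα hα3 hα4 h52 hb hsmall hc₃ S hj z κ hvs hvb',
    star_CCovIter_ins_eq_neg L hL hG hGU k U₀ hU₀ hα hα3 hα4 h52 hb hsmall hc₃ S hj z κ hv hvb.le]
  abel

include hL hG hGU hU₀ hα hα3 hα4 h52 hb hsmall hc₃ in
/-- **the polarisation `D²[C_j(U₀, ins_S ·)(c)](0)(a)(a′)` is skew-adjoint at skew `a, a′`** (any size): it is the limit of the skew quotients
`r⁻¹D[C_j](ra)(a′)`, `r → 0⁺` (`D[C_j](0) = 0`). [cite: Balaban1985Averaging, (136)–(137) p.39, (22)–(23) p.21] [cite: Balaban1985Variational, (56) p.286] -/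
theorem star_snd_fderiv_CCovIter_ins_skew {j : ℕ} (hj : j ≤ k) (z : Site d) (κ : Fin d) {a a' : S → 𝔸} (ha : star a = -a)
    (ha' : star a' = -a') :
    star (fderiv ℂ (fderiv ℂ (fun v : S → 𝔸 => CCovIter L U₀ (insCfg S v) j z κ)) 0 a a') =
      -fderiv ℂ (fderiv ℂ (fun v : S → 𝔸 => CCovIter L U₀ (insCfg S v) j z κ)) 0 a a' := by
  have hg := hasDerivAt_fderiv_CCovIter_ins_slice L hL hG k U₀ hU₀ hα hα3 hα4 h52 hb hsmall hc₃ S hj z κ a a'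
  have h0 : fderiv ℂ (fun v : S → 𝔸 => CCovIter L U₀ (insCfg S v) j z κ) ((0 : ℂ) • a) a' = 0 := by
    rw [zero_smul, fderiv_CCovIter_ins_zero L hL hG k U₀ hU₀ hα hα3 hα4 h52 hb hsmall hc₃ S hj z κ, zero_apply]
  refine skew_of_hasDerivAt hg h0 ?_
  have hroom : ∀ᶠ r : ℝ in 𝓝[>] 0, r * ‖a‖ < b := by
    have hc : ContinuousAt (fun r : ℝ => r * ‖a‖) 0 := (continuous_id.mul continuous_const).continuousAt
    exact nhdsWithin_le_nhds (hc.eventually (p := fun x => x < b) (by simp only [zero_mul]; exact gt_mem_nhds hb))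
  filter_upwards [hroom, self_mem_nhdsWithin] with r hr hr0
  have hr0' : 0 < r := hr0
  have hva : star ((r : ℂ) • a) = -((r : ℂ) • a) := by
    rw [star_smul, ha, Complex.star_def, Complex.conj_ofReal, smul_neg]
  have hvb : ‖(r : ℂ) • a‖ < b := by rwa [norm_smul, Complex.norm_real, Real.norm_of_nonneg hr0'.le]
  exact star_fderiv_CCovIter_ins L hL hG hGU k U₀ hU₀ hα hα3 hα4 h52 hb hsmall hc₃ S hj z κ hva hvb ha'

include hL hG hGU hU₀ hα hα3 hα4 h52 hb hsmall hc₃ in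
/-- ★★ **THE REALITY LAW OF THE POLARISATION OF `C_j⁽²⁾`**: for ALL `a, a′ ∈ 𝔸^S`,
`(D²[C_j(U₀, ins_S ·)(c)](0)(a)(a′))⋆ = −D²[C_j(U₀, ins_S ·)(c)](0)(a⋆)(a′⋆)` — the symmetric bilinear form obtained by polarisation from
`C_j⁽²⁾` ([B11] (56)) is REAL in the sense that it maps `𝔤 × 𝔤` to `𝔤` (`𝔤 =` skew-adjoint elements, the `i` absorbed); over a unitary-valued
regular background, regime of Proposition 4∕(149), gauge group `G ≤ U(𝔸)`. [cite: Balaban1985Averaging, (136) p.39, Proposition 4 p.38, (22)–(23) p.21]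
[cite: Balaban1985Variational, (56) p.286] -/
theorem star_snd_fderiv_CCovIter_ins {j : ℕ} (hj : j ≤ k) (z : Site d) (κ : Fin d) (a a' : S → 𝔸) :
    star (fderiv ℂ (fderiv ℂ (fun v : S → 𝔸 => CCovIter L U₀ (insCfg S v) j z κ)) 0 a a') =
      -fderiv ℂ (fderiv ℂ (fun v : S → 𝔸 => CCovIter L U₀ (insCfg S v) j z κ)) 0 (star a) (star a') :=
  star_apply_eq_neg_of_skew S _
    (fun _ _ hx hy => star_snd_fderiv_CCovIter_ins_skew L hL hG hGU k U₀ hU₀ hα hα3 hα4 h52 hb hsmall hc₃ S hj z κ hx hy) a a'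

include hL hG hGU hU₀ hα hα3 hα4 h52 hb hsmall hc₃ in
/-- ★ **`C_j⁽²⁾(U₀, ins_S a)(c)⋆ = −C_j⁽²⁾(U₀, ins_S a⋆)(c)`** — the second-order term (136) takes `𝔤`-valued families to `𝔤` (the slice
definition is the diagonal of the polarisation, `B7Eq136SecondOrder.CCovIter2_ins_eq`). [cite: Balaban1985Averaging, (136) p.39, (22)–(23) p.21] -/
theorem star_CCovIter2_ins {j : ℕ} (hj : j ≤ k) (z : Site d) (κ : Fin d) (a : S → 𝔸) :
    star (CCovIter2 L U₀ (insCfg S a) j z κ) = -CCovIter2 L U₀ (insCfg S (star a)) j z κ := by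
  rw [CCovIter2_ins_eq L hL hG k U₀ hU₀ hα hα3 hα4 h52 hb hsmall hc₃ S hj z κ a,
    CCovIter2_ins_eq L hL hG k U₀ hU₀ hα hα3 hα4 h52 hb hsmall hc₃ S hj z κ (star a), star_smul,
    star_snd_fderiv_CCovIter_ins L hL hG hGU k U₀ hU₀ hα hα3 hα4 h52 hb hsmall hc₃ S hj z κ a a, smul_neg]
  norm_num

include hL hα hα3 hα4 h52 hb hsmall hc₃ in
/-- ★ the reality law at the gauge group `U(𝔸)` itself (`B7Prop2Explicit.avgClosed_unitaryUnits`): for a UNITARY-valued regular background,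
`(D²[C_j(U₀, ins_S ·)(c)](0)(a)(a′))⋆ = −D²[C_j(U₀, ins_S ·)(c)](0)(a⋆)(a′⋆)` for all `a, a′`. [cite: Balaban1985Averaging, (136) p.39, (42) p.23, (22)–(23) p.21]
[cite: Balaban1985Variational, (56) p.286] -/
theorem star_snd_fderiv_CCovIter_ins_unitary (hU₀ : ∀ x κ, U₀ x κ ∈ unitaryUnits 𝔸) {j : ℕ} (hj : j ≤ k) (z : Site d) (κ : Fin d) (a a' : S → 𝔸) :
    star (fderiv ℂ (fderiv ℂ (fun v : S → 𝔸 => CCovIter L U₀ (insCfg S v) j z κ)) 0 a a') =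
      -fderiv ℂ (fderiv ℂ (fun v : S → 𝔸 => CCovIter L U₀ (insCfg S v) j z κ)) 0 (star a) (star a') :=
  star_snd_fderiv_CCovIter_ins L hL (avgClosed_unitaryUnits d L) le_rfl k U₀ hU₀ hα hα3 hα4 h52 hb hsmall hc₃ S hj z κ a a'

end Polarisation

end Literature.MathematicalPhysics.QuantumFieldTheory.Balaban1983to89.B7Eq136SecondOrderSkewAdjoint
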